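import Summits.ResolutionOfSingularities.ResolutionOfSingularities.Theorems.PAlterationPalterationThesisPialtOfPerfect
import Summits.ResolutionOfSingularities.ResolutionOfSingularities.Theorems.PAlterationPialtNormalProjective
import Summits.ResolutionOfSingularities.ResolutionOfSingularities.Theorems.WildQuotientsGaloisQuotientAlteration
import Summits.ResolutionOfSingularities.ResolutionOfSingularities.Theorems.WildQuotientsSummitReductionTrivialCases
import Summits.ResolutionOfSingularities.ResolutionOfSingularities.Theses.WildQuotients
import HarnessLib

/-!
# `WildQuotients.GaloisReduction` (stmt-ResolutionOfSingularities-15641): the PERFECT SQUEEZE, frame —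
# the item is its own restriction to normal projective varieties over perfect fields

Route `ResolutionOfSingularities/WildQuotients`, support item `GaloisReduction`
(`:= WildQuotientResolution → Pialt`). The item is closed in tree modulo the named fact
`Literature.AlgebraicGeometry.Resolution.DeJong1997_galoisAlterationQuasiProjective` (de Jong
1997, Thm. 5.13 / Cor. 5.15, over EVERY field and for EVERY integral separated finite-type `X`):
`Theorems.galoisReduction_of_deJong1997` (`…WildQuotientsGaloisReductionOfDeJong1997`).

This file is the FRAME of the squeeze of that dependence (companion
`…WildQuotientsGaloisReductionPerfectSqueezeDeJong` plugs de Jong's datum in): the target side of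
the item, `Pialt`, needs to be established only for NORMAL PROJECTIVE integral varieties over
PERFECT fields of characteristic `p`, with no hypothesis on resolution — purely inseparable
regular alterations descend from the perfect closure (`stub_pialtOfPerfect`, in tree: finite-level
descent, regularity by flat descent, Matsumura 23.7 (i)) and, over a fixed field, reduce to normal
projective varieties (Chow's lemma, projective closure, normalisation:
`pialtConclusion_of_forall_normal_isProjectiveOver`, in tree). On the source side, two clauses of
the de Jong datum that the quotient construction consumes are FREE for a discharger: faithfulness
of the action (pass to the image `ρ.range ≤ Aut X₁`) and "finite subsets lie in affine opens"
(automatic for `X₁` projective over `k`, graded prime avoidance — the tree's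
`IsProjectiveOver.finiteSubsetsInAffineOpens` / `finset_subset_affineOpen_of_isProjectiveOver`).

Results (all unconditional):

* `pialtAt_of_pialtPerfectNormalProjectiveAt` — `PIAlt_p` over every field of characteristic `p`
  from `PIAlt_p` for normal projective varieties over perfect fields;
* `galoisAlterationDatum_faithful` — in de Jong's datum `(G, X₁, ρ, π)` the clause
  `Function.Injective ρ` is free;
* `galoisAlterationDatum_of_isProjectiveOver` — the TEXTBOOK datum (de Jong 1996, Thm. 7.3: `X₁` regular integral PROJECTIVE over `k`, `G`
  finite acting, `π` a `G`-invariant alteration, `K(X) ⊂ K(X₁)^G` purely inseparable) yields the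
  datum of the named fact (faithful group, finite subsets in affine opens);
* `galoisReduction_iff_perfectField_normal_isProjectiveOver` — the item IS the statement
  "`WildQuotientResolution` gives PIAlt for normal projective varieties over perfect fields"
  (where a discharge, or a counterexample, is to be sought).
-/


-- single-problem summit: the doubled namespace component `ResolutionOfSingularities` is forced
set_option linter.dupNamespace false

noncomputable section

open CategoryTheory CategoryTheory.Limits AlgebraicGeometry TopologicalSpace
open Literature.AlgebraicGeometry.Resolution
open Literature.AlgebraicGeometry.Motives (RatFn.functionFieldMap)
open Literature.AlgebraicGeometry

namespace Summit.ResolutionOfSingularities.ResolutionOfSingularities.Theorems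

/-! ## Steps 1–2: PIAlt at a prime needs only normal projective varieties over perfect fields -/

/-- **`PIAlt_p` over every field of characteristic `p` follows from `PIAlt_p` for NORMAL
PROJECTIVE integral varieties over PERFECT fields of characteristic `p`**: pass to the perfect
closure `k^{p^{-∞}}` and descend the purely inseparable regular alteration to `k`
(`stub_pialtOfPerfect`), after reducing over the perfect field to normal projective varieties by
Chow's lemma, projective closure and normalisation
(`pialtConclusion_of_forall_normal_isProjectiveOver`). [cite: DeJong1996, 4.6–4.7, 4.16]
[cite: Temkin2013, §1.3] -/
theorem pialtAt_of_pialtPerfectNormalProjectiveAt (p : ℕ) (hp : p.Prime)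
    (hPN : ∀ (K : Type) [Field K] [CharP K p] [PerfectField K] (X : Scheme.{0})
      (f : X ⟶ Spec (.of K)), IsIntegral X → Motives.IsProjectiveOver (Over.mk f) →
      (∀ x : X, IsIntegrallyClosed (X.presheaf.stalk x)) →
        ∃ (X' : Scheme.{0}) (g : X' ⟶ X), IsProper g ∧ IsIntegral X' ∧ Scheme.IsRegular X' ∧
          Function.Surjective g.base ∧ ∃ U : X.Opens, Dense (U : Set X) ∧ IsFinite (g ∣_ U) ∧
            UniversallyInjective (g ∣_ U))
    (k : Type) [Field k] [CharP k p] (X : Scheme.{0}) (f : X ⟶ Spec (.of k))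
    (hs : IsSeparated f) (hl : LocallyOfFiniteType f) (hq : QuasiCompact f) (hi : IsIntegral X) :
    ∃ (X' : Scheme.{0}) (g : X' ⟶ X), IsProper g ∧ IsIntegral X' ∧ Scheme.IsRegular X' ∧
      Function.Surjective g.base ∧
      ∃ U : X.Opens, Dense (U : Set X) ∧ IsFinite (g ∣_ U) ∧ UniversallyInjective (g ∣_ U) := by
  haveI : Fact p.Prime := ⟨hp⟩
  haveI := hs; haveI := hl; haveI := hq; haveI := hi
  refine PalterationThesis.PerfectTransfer.stub_pialtOfPerfect p k (fun Y g h1 h2 h3 h4 => ?_) X f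
  haveI := h1; haveI := h2; haveI := h3; haveI := h4
  exact pialtConclusion_of_forall_normal_isProjectiveOver g
    (fun X' f' hi' hproj hN => hPN (PerfectClosure k p) X' f' hi' hproj hN)

/-! ## The faithfulness clause is free -/

/-- **The group may be replaced by its faithful image**: in de Jong's datum `(G, X₁, ρ, π)` the
action `ρ : G →* Aut X₁` need not be injective — replacing `G` by `ρ.range ≤ Aut X₁` keeps the
invariance of `π`, the affine-open clause and the purely inseparable condition (d), which only see
the image (de Jong 1997, 5.3 (b): "`G' → G` is a surjection of finite groups"; the tree's named
fact records the faithful image). [cite: DeJong1997, 5.3, p. 613] -/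
theorem galoisAlterationDatum_faithful {X : Scheme.{0}} [IsIntegral X]
    (h : ∃ (G : Type) (_ : Group G) (_ : Finite G) (X₁ : Scheme.{0}) (_ : IsIntegral X₁)
        (ρ : G →* Aut X₁) (π : X₁ ⟶ X) (_ : IsDominant π),
        IsAlteration π ∧ Scheme.IsRegular X₁ ∧
        (∀ g : G, (ρ g).hom ≫ π = π) ∧
        (∀ S : Finset X₁, ∃ U : X₁.Opens, IsAffineOpen U ∧ (↑S : Set X₁) ⊆ U) ∧
        (∀ a : X₁.functionField, (∀ g : G, RatFn.functionFieldMap (ρ g).hom a = a) →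
          ∃ n : ℕ, a ^ ringExpChar X.functionField ^ n ∈ Set.range (RatFn.functionFieldMap π))) :
    ∃ (G : Type) (_ : Group G) (_ : Finite G) (X₁ : Scheme.{0}) (_ : IsIntegral X₁)
        (ρ : G →* Aut X₁) (π : X₁ ⟶ X) (_ : IsDominant π),
        IsAlteration π ∧ Scheme.IsRegular X₁ ∧ Function.Injective ρ ∧
        (∀ g : G, (ρ g).hom ≫ π = π) ∧
        (∀ S : Finset X₁, ∃ U : X₁.Opens, IsAffineOpen U ∧ (↑S : Set X₁) ⊆ U) ∧
        (∀ a : X₁.functionField, (∀ g : G, RatFn.functionFieldMap (ρ g).hom a = a) →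
          ∃ n : ℕ, a ^ ringExpChar X.functionField ^ n ∈ Set.range (RatFn.functionFieldMap π)) := by
  obtain ⟨G, _, _, X₁, _, ρ, π, _, hπ, hreg, hinv, hfin, hd⟩ := h
  haveI : Finite ρ.range := Finite.of_surjective ρ.rangeRestrict ρ.rangeRestrict_surjective
  refine ⟨ρ.range, inferInstance, inferInstance, X₁, ‹_›, ρ.range.subtype, π, ‹_›, hπ, hreg,
    ρ.range.subtype_injective, ?_, hfin, fun a ha => hd a fun g => ha ⟨ρ g, g, rfl⟩⟩
  rintro ⟨_, g, rfl⟩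
  exact hinv g

/-! ## The textbook form of the residual hypothesis: `X₁` regular PROJECTIVE over `k` -/

/-- **From the textbook datum to the named fact's datum**: a finite group `G` acting on a regular
integral `X₁` PROJECTIVE over `k` with a `G`-invariant alteration `π : X₁ → X` and
`K(X) ⊂ K(X₁)^G` purely inseparable (de Jong 1996, Thm. 7.3 (i)–(ii); de Jong 1997, 5.3 +
(5.12.1)) yields the datum of `DeJong1997_galoisAlterationQuasiProjective` at `X`: faithful group
(`galoisAlterationDatum_faithful`) and finite subsets in affine opens
(`finset_subset_affineOpen_of_isProjectiveOver`, landed with the sibling crux's trivial cases).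
[cite: DeJong1996, Thm. 7.3, p. 88]
[cite: DeJong1997, 5.3 and (5.12.1), pp. 613, 619] -/
theorem galoisAlterationDatum_of_isProjectiveOver {k : Type} [Field k] {X : Scheme.{0}}
    [IsIntegral X] (f : X ⟶ Spec (.of k))
    (h : ∃ (G : Type) (_ : Group G) (_ : Finite G) (X₁ : Scheme.{0}) (_ : IsIntegral X₁)
        (ρ : G →* Aut X₁) (π : X₁ ⟶ X) (_ : IsDominant π),
        IsAlteration π ∧ Scheme.IsRegular X₁ ∧ (∀ g : G, (ρ g).hom ≫ π = π) ∧
        Motives.IsProjectiveOver (Over.mk (π ≫ f)) ∧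
        (∀ a : X₁.functionField, (∀ g : G, RatFn.functionFieldMap (ρ g).hom a = a) →
          ∃ n : ℕ, a ^ ringExpChar X.functionField ^ n ∈ Set.range (RatFn.functionFieldMap π))) :
    ∃ (G : Type) (_ : Group G) (_ : Finite G) (X₁ : Scheme.{0}) (_ : IsIntegral X₁)
        (ρ : G →* Aut X₁) (π : X₁ ⟶ X) (_ : IsDominant π),
        IsAlteration π ∧ Scheme.IsRegular X₁ ∧ Function.Injective ρ ∧
        (∀ g : G, (ρ g).hom ≫ π = π) ∧
        (∀ S : Finset X₁, ∃ U : X₁.Opens, IsAffineOpen U ∧ (↑S : Set X₁) ⊆ U) ∧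
        (∀ a : X₁.functionField, (∀ g : G, RatFn.functionFieldMap (ρ g).hom a = a) →
          ∃ n : ℕ, a ^ ringExpChar X.functionField ^ n ∈ Set.range (RatFn.functionFieldMap π)) := by
  obtain ⟨G, hG, hF, X₁, hI, ρ, π, hD, hπ, hreg, hinv, hproj, hd⟩ := h
  have haff : ∀ S : Finset X₁, ∃ U : X₁.Opens, IsAffineOpen U ∧ (↑S : Set X₁) ⊆ U :=
    finset_subset_affineOpen_of_isProjectiveOver (π ≫ f) hproj
  exact galoisAlterationDatum_faithful ⟨G, hG, hF, X₁, hI, ρ, π, hD, hπ, hreg, hinv, haff, hd⟩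

/-! ## What the item amounts to, unconditionally -/

/-- **`GaloisReduction` is equivalent to its restriction to NORMAL PROJECTIVE varieties over
PERFECT fields**: `WildQuotientResolution → Pialt` holds if and only if `WildQuotientResolution`
yields purely inseparable regular alterations of normal projective integral varieties over perfect
fields of characteristic `p` (perfect closure + descent, Chow + normalisation:
`pialtAt_of_pialtPerfectNormalProjectiveAt`). This is where de Jong's theorem enters
(`galoisReduction_of_forall_perfectField_galoisAlteration`) and where any other discharge of the
item may work. [folklore] -/
theorem galoisReduction_iff_perfectField_normal_isProjectiveOver :
    Theses.WildQuotients.GaloisReduction ↔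
      (Theses.WildQuotients.WildQuotientResolution → ∀ p : ℕ, p.Prime →
        ∀ (K : Type) [Field K] [CharP K p] [PerfectField K] (X : Scheme.{0})
          (f : X ⟶ Spec (.of K)), IsIntegral X → Motives.IsProjectiveOver (Over.mk f) →
          (∀ x : X, IsIntegrallyClosed (X.presheaf.stalk x)) →
            ∃ (X' : Scheme.{0}) (g : X' ⟶ X), IsProper g ∧ IsIntegral X' ∧ Scheme.IsRegular X' ∧
              Function.Surjective g.base ∧ ∃ U : X.Opens, Dense (U : Set X) ∧
                IsFinite (g ∣_ U) ∧ UniversallyInjective (g ∣_ U)) := by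
  refine ⟨fun h hWQ p hp K _ _ _ X f hi hproj _ => ?_, fun h hWQ p hp k _ _ X f hs hl hq hi => ?_⟩
  · haveI : IsProper f := Motives.IsProjectiveOver.isProper hproj
    exact h hWQ p hp K X f inferInstance inferInstance inferInstance hi
  · exact pialtAt_of_pialtPerfectNormalProjectiveAt p hp (fun K _ _ _ Y g => h hWQ p hp K Y g)
      k X f hs hl hq hi

end Summit.ResolutionOfSingularities.ResolutionOfSingularities.Theorems

end
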